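import Summits.AtomisticToContinuum.BoseEinsteinCondensation.Theorems.BECGroundStateSOSPeriodicIRBoundTwoSectorKato
import Summits.AtomisticToContinuum.BoseEinsteinCondensation.Theorems.BECInsertionCorrectorCorrectorClosureHoleKLS
import Summits.AtomisticToContinuum.BoseEinsteinCondensation.Theorems.BECInsertionCorrectorCorrectorClosureResponseDictionarySymm
import Summits.AtomisticToContinuum.BoseEinsteinCondensation.Theorems.BECFeynmanVortexAreaVortexAreaToPeriodicBEC
import Summits.AtomisticToContinuum.BoseEinsteinCondensation.Theorems.BECInsertionCorrectorStaticResponseBoundFloorToHyperuniformity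
import Literature.MathematicalPhysics.QuantumManyBody.WeightedCorrector
import Literature.MathematicalPhysics.QuantumManyBody.TorusFockLayer
import HarnessLib

/-!
# Line `insertion-mode-gaussian-domination`, auxiliary theorem `holeModeDomination_of_gaussianDomination` —
# hole-mode Gaussian domination C⁺ from the sibling crux `GaussianDomination` (item 12620)
# (crux `BECInsertionCorrector.CorrectorClosure`, item stmt-AtomisticToContinuum-12058)

Supports (does not close) stmt-AtomisticToContinuum-12058. The heart S3 of the line asserts, for a bounded admissible
`v`, the true `(N+1)`-body torus Feynman–Kac ground state `Φ₀`, the `N`-body one `Θ₀` (the Kipnis–Varadhan weight) and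
a window mode `n ≠ 0`, `‖p‖² ≤ M₀²ρa` (`p = latticeVec (2π/L) n`), the HOLE-MODE GAUSSIAN DOMINATION
`b₋(n) := ‖Re a(φ_n)Φ₀/Θ₀‖²₋₁ + ‖Im a(φ_n)Φ₀/Θ₀‖²₋₁ ≤ Bρ/‖p‖⁴` (`hMinusOneSqW` norms, `a(φ_n) = modeAn L (planeWaveMode L n)`).
This file shows that C⁺ follows from the sibling crux `BECTwoSectorGD.GaussianDomination` (stmt-12620): the
one-particle-transfer susceptibility bound `b ≤ CL²/‖n‖²_∞` is two powers STRONGER than C⁺ on the window.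

Chain (every analytic input is a landed lemma):
* `gaussianDomination_iff` + the Kato step `Kato.twoChannel_of_gd` give `SuscMinus v N L n (CL²/‖n‖²_∞)` at the
  pair `(N, N+1)` on the torus `L = sideLength ρ (N+1)` (`(N+1)/L³ = ρ ≤ ρ₀`, and the window forces `2π‖n‖_∞/L ≤ K`);
* at the EXACT minimiser `Φ = (Φ₀ : ℂ)` (`stub_periodicGroundStateRegularity`, `exists_trialState_of_fk`,
  `periodicEnergy_le_of_isPeriodicGroundStateFK`) the regularised bound gives `(Re⟨Ψ, a(φ_n)Φ⟩)² ≤ b(E(Ψ) − E₀(N))`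
  for every finite-energy `Ψ` (`transfer_sq_le_of_suscMinus`, `η → 0`);
* for a symmetric periodic test `β`, the tilted state `Ψ = c·βΘ₀/‖βΘ₀‖` (`|c| = 1`; `WF.IsCore.toTrialState`) has
  `E(Ψ) − E₀(N) = 𝓔_Θ₀(β,β)/‖βΘ₀‖²` by the ground-state representation `tilt_identity`, and
  `Re⟨Ψ, aΦ⟩ = ‖βΘ₀‖⁻¹ ∫ Θ₀² β g`, `g = Re(c̄·aΦ)/Θ₀`; hence `(∫Θ₀²βg)² ≤ b·𝓔_Θ₀(β,β)`, i.e. `2∫Θ₀²βg − 𝓔_Θ₀(β,β) ≤ b`, and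
  symmetric tests suffice (`hMinusOneSqW_le_of_symmetric_tests`): `‖g‖²₋₁ ≤ b` for `c = 1` (`g = Re aΦ/Θ₀`) and
  `c = i` (`g = Im aΦ/Θ₀`) (`hMinusOneSqW_quadrature_le`);
* window arithmetic: `2b = 2CL²/‖n‖²_∞ ≤ 24π²C/‖p‖² ≤ (24π²CM₀²a + 1)ρ/‖p‖⁴` (`Σnᵢ² ≤ 3‖n‖²_∞`).
References (shape only): T. Kennedy, E. H. Lieb, B. S. Shastry, J. Stat. Phys. 53 (1988) 1019, (12)–(14);
C. Kipnis, S. R. S. Varadhan, Comm. Math. Phys. 104 (1986) 1, (1.14).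
-/

noncomputable section

open MeasureTheory Filter
open scoped ENNReal NNReal BigOperators ComplexConjugate

namespace Summit.AtomisticToContinuum.BoseEinsteinCondensation.Theorems.CorrectorClosure.InsertionModeGaussianDomination

open Summit.AtomisticToContinuum.BoseEinsteinCondensation.Cruxes.StaticResponseBound.StableFractionSquareCompletion
  (fb_sum_sq_pos)

open Literature.MathematicalPhysics.QuantumManyBody.BoseGas
open Summit.AtomisticToContinuum.BoseEinsteinCondensation.Cruxes.PeriodicIRBound.LinearPhFloorWagner.WF
open Summit.AtomisticToContinuum.BoseEinsteinCondensation.Cruxes.PeriodicIRBound.TwoSectorGdTransfer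
open Summit.AtomisticToContinuum.BoseEinsteinCondensation.Theorems.CorrectorClosure.GeometricMeanCorrector
  (exists_trialState_of_fk)
open Summit.AtomisticToContinuum.BoseEinsteinCondensation.Cruxes.HardCoreExtension.ThirdLawCurrentFloor
  (stub_periodicGroundStateRegularity)
open Summit.AtomisticToContinuum.BoseEinsteinCondensation.Theorems.TorusGroundState (periodicEnergy_le_of_isPeriodicGroundStateFK)
open Summit.AtomisticToContinuum.BoseEinsteinCondensation.Theorems.CorrectorClosure.HealingScaleKacInsertion.ResponseDictionary
  (hMinusOneSqW_le_of_symmetric_tests)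
open Summit.AtomisticToContinuum.BoseEinsteinCondensation.Theorems.VortexAreaToPeriodicBEC (lintegral_ne_top_of_bounded)
open Summit.AtomisticToContinuum.BoseEinsteinCondensation.Cruxes.StaticResponseBound.StableFractionSquareCompletion
  (b1_norm_latticeVec_sq)
open Summit.AtomisticToContinuum.BoseEinsteinCondensation.Theorems.CorrectorClosure.Negative (sideLength_succ_pos)

/-! ### Window arithmetic: the sup norm of `n ∈ ℤ³` versus `Σᵢ nᵢ²` -/

/-- `Σᵢ nᵢ² ≤ 3‖n‖²_∞` for `n ∈ ℤ³` read in `ℝ³` with the sup norm. [folklore] -/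
theorem sum_sq_le_three_mul_supNorm_sq (n : Fin 3 → ℤ) :
    ∑ i, (n i : ℝ) ^ 2 ≤ 3 * ‖(fun j => (n j : ℝ))‖ ^ 2 := by
  have h : ∀ i, (n i : ℝ) ^ 2 ≤ ‖(fun j => (n j : ℝ))‖ ^ 2 := fun i => by
    rw [← sq_abs, ← Real.norm_eq_abs]
    exact pow_le_pow_left₀ (norm_nonneg _) (norm_le_pi_norm (fun j => (n j : ℝ)) i) 2
  calc ∑ i, (n i : ℝ) ^ 2 ≤ ∑ _i : Fin 3, ‖(fun j => (n j : ℝ))‖ ^ 2 := Finset.sum_le_sum fun i _ => h i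
    _ = 3 * ‖(fun j => (n j : ℝ))‖ ^ 2 := by
        rw [Finset.sum_const, Finset.card_univ, Fintype.card_fin, nsmul_eq_mul, Nat.cast_ofNat]

/-- `‖n‖²_∞ ≤ Σᵢ nᵢ²`. [folklore] -/
theorem supNorm_sq_le_sum_sq (n : Fin 3 → ℤ) :
    ‖(fun j => (n j : ℝ))‖ ^ 2 ≤ ∑ i, (n i : ℝ) ^ 2 := by
  have hS0 : 0 ≤ ∑ i, (n i : ℝ) ^ 2 := Finset.sum_nonneg fun i _ => sq_nonneg _
  have h1 : ‖(fun j => (n j : ℝ))‖ ≤ Real.sqrt (∑ i, (n i : ℝ) ^ 2) := by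
    refine (pi_norm_le_iff_of_nonneg (Real.sqrt_nonneg _)).2 fun i => ?_
    rw [Real.norm_eq_abs]
    exact Real.abs_le_sqrt
      (Finset.single_le_sum (f := fun i => (n i : ℝ) ^ 2) (fun j _ => sq_nonneg _) (Finset.mem_univ i))
  calc ‖(fun j => (n j : ℝ))‖ ^ 2 ≤ Real.sqrt (∑ i, (n i : ℝ) ^ 2) ^ 2 :=
        pow_le_pow_left₀ (norm_nonneg _) h1 2
    _ = _ := Real.sq_sqrt hS0

/-- **Window arithmetic.** With `t = ‖p‖² = (2π/L)²·Σnᵢ²`, `Σnᵢ² ≤ 3ν²` (`ν = ‖n‖_∞ > 0`) and the window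
`t ≤ M₀²ρa`: `2·CL²/ν² ≤ (24π²CM₀²a + 1)·ρ/t²`. [folklore] -/
theorem window_arith {C L ν S t ρ M₀ a : ℝ} (hC : 0 ≤ C) (hL : 0 < L) (hν : 0 < ν) (hS : S ≤ 3 * ν ^ 2)
    (ht : t = (2 * Real.pi / L) ^ 2 * S) (ht0 : 0 < t) (hρ : 0 < ρ) (hwin : t ≤ M₀ ^ 2 * ρ * a) :
    C * L ^ 2 / ν ^ 2 + C * L ^ 2 / ν ^ 2 ≤ (24 * Real.pi ^ 2 * C * M₀ ^ 2 * a + 1) * ρ / t ^ 2 := by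
  rw [← add_div, div_le_div_iff₀ (pow_pos hν 2) (pow_pos ht0 2)]
  have h1 : (C * L ^ 2 + C * L ^ 2) * t ^ 2 = 8 * Real.pi ^ 2 * C * (S * t) := by rw [ht]; field_simp; ring
  have h2 : S * t ≤ 3 * ν ^ 2 * (M₀ ^ 2 * ρ * a) := mul_le_mul hS hwin ht0.le (by positivity)
  have h3 : 0 ≤ ρ * ν ^ 2 := by positivity
  calc (C * L ^ 2 + C * L ^ 2) * t ^ 2 = 8 * Real.pi ^ 2 * C * (S * t) := h1
    _ ≤ 8 * Real.pi ^ 2 * C * (3 * ν ^ 2 * (M₀ ^ 2 * ρ * a)) := mul_le_mul_of_nonneg_left h2 (by positivity)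
    _ = (24 * Real.pi ^ 2 * C * M₀ ^ 2 * a) * ρ * ν ^ 2 := by ring
    _ ≤ (24 * Real.pi ^ 2 * C * M₀ ^ 2 * a + 1) * ρ * ν ^ 2 := by nlinarith [h3]

/-! ### From the regularised susceptibility bound to Kipnis–Varadhan's criterion -/

/-- **The plain channel-`−` bound at the exact minimiser.** If `SuscMinus v N L n b` (`b ≥ 0`) and `Φ` ATTAINS
`E₀(N+1)`, then `(Re⟨Ψ, a(φ_n)Φ⟩)² ≤ b·(E(Ψ) − E₀(N))` for every finite-energy `N`-body `Ψ` (`Φ` is a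
`δ`-near-minimiser for every `δ > 0`; let `η → 0`). [cite: KLS1988JSP, (12)–(14)] -/
theorem transfer_sq_le_of_suscMinus {v : ℝ → ℝ≥0∞} {N : ℕ} {L : ℝ} {n : Fin 3 → ℤ} {b : ℝ} (hb : 0 ≤ b)
    (hSM : SuscMinus v N L n b) (Φ : PeriodicTrialState (N + 1) L)
    (hΦmin : periodicEnergy v Φ = periodicGroundStateEnergy v (N + 1) L) (Ψ : PeriodicTrialState N L)
    (hΨ : periodicEnergy v Ψ ≠ ⊤) :
    (Real.sqrt ((N : ℝ) + 1) * transferIntegralRe L n Ψ.ψ Φ.ψ) ^ 2 ≤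
      b * ((periodicEnergy v Ψ).toReal - (periodicGroundStateEnergy v N L).toReal) := by
  set Y : ℝ := (periodicEnergy v Ψ).toReal - (periodicGroundStateEnergy v N L).toReal with hY
  have hY0 : 0 ≤ Y := sub_nonneg.2 (ENNReal.toReal_mono hΨ (periodicGroundStateEnergy_le v Ψ))
  refine le_of_forall_pos_le_add fun ε hε => ?_
  have hK : 0 < b * (Y + 1) + 1 := by positivity
  have hη0 : 0 < ε / (b * (Y + 1) + 1) := div_pos hε hK
  obtain ⟨δ, -, H⟩ := hSM _ hη0
  have hnear : NearMinAt v δ Φ := by unfold NearMinAt; rw [hΦmin]; exact le_self_add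
  have h := H Φ hnear Ψ hΨ
  have hηb : ε / (b * (Y + 1) + 1) * (b * (Y + 1)) ≤ ε := by
    rw [div_mul_eq_mul_div, div_le_iff₀ hK]
    nlinarith [mul_nonneg hb hY0, hε.le]
  calc _ ≤ b * ((1 + ε / (b * (Y + 1) + 1)) * Y + ε / (b * (Y + 1) + 1)) := h
    _ = b * Y + ε / (b * (Y + 1) + 1) * (b * (Y + 1)) := by ring
    _ ≤ b * Y + ε := by linarith

/-- **The form of a real `C¹` function read in `ℂ`**: finite for integrable `w`, and `(𝓔_w[u]).toReal = ∫|∇u|² + ∫ V u²`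
(`WF.toReal_qform`, `kineticDensityReal_eq_gradDot_add`, `WF.integral_potReal`). [folklore] -/
theorem qform_ofReal {M : ℕ} {L : ℝ} (hL : 0 < L) {w : ℝ → ℝ≥0∞} (hw : Measurable w)
    (hint : (∫⁻ x : Space, w ‖x‖) ≠ ⊤) {u : Config M → ℝ} (hu : ContDiff ℝ 1 u) :
    qform w L (fun Y => ((u Y : ℝ) : ℂ)) ≠ ⊤ ∧
      (qform w L (fun Y => ((u Y : ℝ) : ℂ))).toReal =
        (∫ X in cellN M L, gradDot u u X) + ∫ X in cellN M L, (periodicInteraction w L X).toReal * u X ^ 2 := by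
  have huC : ContDiff ℝ 1 (fun Y => ((u Y : ℝ) : ℂ)) := Complex.ofRealCLM.contDiff.comp hu
  have hcont : Continuous fun Y => ((u Y : ℝ) : ℂ) := huC.continuous
  have hP : potForm w L (fun Y => ((u Y : ℝ) : ℂ)) ≠ ⊤ := PotCross.potForm_ne_top hL hw hint hcont
  refine ⟨?_, ?_⟩
  · rw [qform_eq_kinetic_add_potPart w L huC]
    exact ENNReal.add_ne_top.2 ⟨ENNReal.ofReal_ne_top, hP⟩
  · rw [toReal_qform w L huC hP]
    congr 1
    · unfold cellKineticEnergy
      refine integral_congr_ae (ae_of_all _ fun X => ?_)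
      rw [kineticDensityReal_eq_gradDot_add (huC.differentiable one_ne_zero) X]
      have h1 : (fun Y => (((u Y : ℝ) : ℂ)).re) = u := funext fun Y => Complex.ofReal_re _
      have h2 : (fun Y => (((u Y : ℝ) : ℂ)).im) = fun _ => (0 : ℝ) := funext fun Y => Complex.ofReal_im _
      have h3 : gradDot (fun _ : Config M => (0 : ℝ)) (fun _ => (0 : ℝ)) X = 0 := by simp [gradDot]
      rw [h1, h2, h3, add_zero]
    · rw [← integral_potReal hw hcont hP]
      refine integral_congr_ae (ae_of_all _ fun X => ?_)
      simp only [Complex.norm_real, Real.norm_eq_abs, sq_abs]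

/-- **Kipnis–Varadhan's bound for one quadrature of the hole state from the removal susceptibility.** Let `Θ₀ > 0` be
`C¹`, lattice-periodic and Bose-symmetric with `(Θ₀ : ℂ)` a periodic trial state attaining `E₀(N) < ∞`, let the
`(N+1)`-body `Φ` attain `E₀(N+1)`, and let `SuscMinus v N L n b` (`b ≥ 0`, `∫ v < ∞`). Then for every unit `c ∈ ℂ`,
`g := Re(c̄ · a(φ_n)Φ)/Θ₀` has `‖g‖²₋₁ ≤ b` (weight `Θ₀`): for a symmetric periodic test `β` the tilted state
`Ψ = c βΘ₀/‖βΘ₀‖` has `E(Ψ) − E₀(N) = 𝓔_Θ₀(β,β)/‖βΘ₀‖²` (`tilt_identity`) and `Re⟨Ψ, aΦ⟩ = ∫Θ₀²βg/‖βΘ₀‖`, so the plain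
channel bound reads `(∫Θ₀²βg)² ≤ b·𝓔_Θ₀(β,β)`, whence `2∫Θ₀²βg − 𝓔_Θ₀(β,β) ≤ b`; symmetric tests suffice
(`hMinusOneSqW_le_of_symmetric_tests`). [cite: KipnisVaradhan1986, (1.14)] -/
theorem hMinusOneSqW_quadrature_le {N : ℕ} {L : ℝ} (hL : 0 < L) {v : ℝ → ℝ≥0∞} (hw : Measurable v)
    (hint : (∫⁻ x : Space, v ‖x‖) ≠ ⊤) {Θ₀ : Config N → ℝ} (ΘT : PeriodicTrialState N L)
    (hΘT : ΘT.ψ = fun X => ((Θ₀ X : ℝ) : ℂ)) (hΘp : ∀ X, 0 < Θ₀ X) (hΘC1 : ContDiff ℝ 1 Θ₀)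
    (hΘper : IsLatticePeriodic L Θ₀) (hΘsymm : ∀ (σ : Equiv.Perm (Fin N)) (X : Config N), Θ₀ (X ∘ σ) = Θ₀ X)
    (hEΘ : periodicEnergy v ΘT = periodicGroundStateEnergy v N L) (hΘfin : periodicEnergy v ΘT ≠ ⊤)
    (Φ : PeriodicTrialState (N + 1) L) (hΦmin : periodicEnergy v Φ = periodicGroundStateEnergy v (N + 1) L)
    {n : Fin 3 → ℤ} {b : ℝ} (hb : 0 ≤ b) (hSM : SuscMinus v N L n b) (c : ℂ) (hc : ‖c‖ = 1) :
    hMinusOneSqW L Θ₀ (fun Y => (conj c * modeAn L (planeWaveMode L n) Φ.ψ Y).re / Θ₀ Y) ≤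
      ENNReal.ofReal b := by
  have haC : IsCore L (modeAn L (planeWaveMode L n) Φ.ψ) := isCore_modeAn hL n (isCore_trialState Φ)
  have haCont : Continuous (modeAn L (planeWaveMode L n) Φ.ψ) := haC.contDiff.continuous
  have hΘ0 : ∀ Y, Θ₀ Y ≠ 0 := fun Y => (hΘp Y).ne'
  have hΘc : Continuous Θ₀ := hΘC1.continuous
  -- the real observable `r = Re(c̄ aΦ)` and `g = r/Θ₀`
  set r : Config N → ℝ := fun Y => (conj c * modeAn L (planeWaveMode L n) Φ.ψ Y).re with hr
  have hrCont : Continuous r := Complex.continuous_re.comp (continuous_const.mul haCont)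
  have hg : Continuous fun Y => r Y / Θ₀ Y := hrCont.div hΘc hΘ0
  have hgsymm : ∀ (σ : Equiv.Perm (Fin N)) (X : Config N), r (X ∘ σ) / Θ₀ (X ∘ σ) = r X / Θ₀ X := by
    intro σ X
    simp only [hr, haC.symm σ X, hΘsymm σ X]
  set e₀ : ℝ := (periodicGroundStateEnergy v N L).toReal with he₀
  refine hMinusOneSqW_le_of_symmetric_tests L hg hgsymm hΘc hΘsymm fun β hβ hβsymm => ?_
  show 2 * (∫ X in cellN N L, Θ₀ X ^ 2 * (β X * (r X / Θ₀ X))) -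
      (∫ X in cellN N L, Θ₀ X ^ 2 * gradDot β β X) ≤ b
  -- the pairing `A` and the Dirichlet form `D`; it suffices that `A² ≤ b D`
  set A : ℝ := ∫ X in cellN N L, Θ₀ X ^ 2 * (β X * (r X / Θ₀ X)) with hA
  set D : ℝ := ∫ X in cellN N L, Θ₀ X ^ 2 * gradDot β β X with hD
  have hD0 : 0 ≤ D := integral_nonneg fun X => mul_nonneg (sq_nonneg _) (gradDot_self_nonneg β X)
  suffices hkey : A ^ 2 ≤ b * D by
    nlinarith [sq_nonneg (b - D), sq_nonneg (2 * A - b - D), hkey, hb, hD0, mul_nonneg hb hD0]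
  -- the tilted function `u = β Θ₀` and the core `c u`
  set u : Config N → ℝ := fun Y => β Y * Θ₀ Y with hu
  have huC1 : ContDiff ℝ 1 u := hβ.1.mul hΘC1
  have huper : IsLatticePeriodic L u := fun X i k => by
    simp only [hu, hβ.2 X i k, hΘper X i k]
  have husymm : ∀ (σ : Equiv.Perm (Fin N)) (X : Config N), u (X ∘ σ) = u X := fun σ X => by
    simp only [hu, hβsymm σ X, hΘsymm σ X]
  have hAu : A = ∫ X in cellN N L, u X * r X := by
    refine integral_congr_ae (ae_of_all _ fun X => ?_)
    have hX := hΘ0 X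
    show Θ₀ X ^ 2 * (β X * (r X / Θ₀ X)) = β X * Θ₀ X * r X
    field_simp
  set uR : Config N → ℂ := fun Y => ((u Y : ℝ) : ℂ) with huR
  set uC : Config N → ℂ := fun Y => c * uR Y with huC
  have huRC1 : ContDiff ℝ 1 uR := Complex.ofRealCLM.contDiff.comp huC1
  have hcore : IsCore L uC :=
    ⟨contDiff_const.mul huRC1,
      fun X i k => by simp only [huC, huR, huper X i k],
      fun σ X => by simp only [huC, huR, husymm σ X]⟩
  have hc1 : ((‖c‖₊ : ℝ≥0∞)) ^ 2 = 1 := by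
    rw [coe_nnnorm_sq_eq_ofReal, hc, one_pow, ENNReal.ofReal_one]
  have hnormC : normSq L uC = normSq L uR := by
    rw [huC, normSq_const_mul, hc1, one_mul]
  have hqC : qform v L uC = qform v L uR := by
    rw [huC, qform_const_mul v L c (huRC1.differentiable one_ne_zero), hc1, one_mul]
  -- mass `m = ∫ u²`
  set m : ℝ := ∫ X in cellN N L, u X ^ 2 with hm
  have hmR : (normSq L uR).toReal = m := by
    rw [toReal_normSq huRC1.continuous]
    refine integral_congr_ae (ae_of_all _ fun X => ?_)
    simp only [huR, Complex.norm_real, Real.norm_eq_abs, sq_abs]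
  have hmC : (normSq L uC).toReal = m := by rw [hnormC, hmR]
  have htop : normSq L uC ≠ ⊤ := (normSq_lt_top L hcore.contDiff.continuous).ne
  -- energy `(𝓔[u]).toReal = e₀ m + D` (ground-state representation)
  obtain ⟨hqRtop, hqR⟩ := qform_ofReal hL hw hint huC1
  have htilt := tilt_identity hw ΘT hΘT hΘp hΘC1 hΘper hEΘ hΘfin huC1 huper
  have hβu : (fun Y => u Y / Θ₀ Y) = β := funext fun Y => mul_div_cancel_right₀ (β Y) (hΘ0 Y)
  rw [hβu, hEΘ] at htilt
  have hDW : dirichletFormW L Θ₀ β β = D := by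
    rw [dirichletFormW]
    exact integral_congr_ae (ae_of_all _ fun X => mul_comm _ _)
  have hqRval : (qform v L uR).toReal = e₀ * m + D := by rw [hqR, htilt, hDW]
  rcases eq_or_ne (normSq L uC) 0 with h0 | h0
  · -- `u = 0` a.e. on the cell, so `A = 0`
    have hm0 : m = 0 := by rw [← hmC, h0, ENNReal.toReal_zero]
    have hint2 : Integrable (fun X => u X ^ 2) (volume.restrict (cellN N L)) :=
      integrableOn_cellN (huC1.continuous.pow 2) L
    have hae : (fun X => u X ^ 2) =ᵐ[volume.restrict (cellN N L)] 0 :=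
      (integral_eq_zero_iff_of_nonneg (fun X => sq_nonneg (u X)) hint2).1 hm0
    have hA0 : A = 0 := by
      rw [hAu]
      refine integral_eq_zero_of_ae (hae.mono fun X hX => ?_)
      have hu0 : u X = 0 := pow_eq_zero_iff two_ne_zero |>.1 hX
      simp [hu0]
    rw [hA0]
    simpa using mul_nonneg hb hD0
  -- the normalised tilted state `Ψ = c u/‖u‖`
  have hm0 : 0 < m := by rw [← hmC]; exact ENNReal.toReal_pos h0 htop
  set Ψ : PeriodicTrialState N L := hcore.toTrialState h0 htop with hΨ
  have hΨψ : Ψ.ψ = fun X => ((Real.sqrt (normSq L uC).toReal)⁻¹ : ℂ) * uC X := hcore.toTrialState_ψ h0 htop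
  have hΨE : periodicEnergy v Ψ = (normSq L uC)⁻¹ * qform v L uC := hcore.periodicEnergy_toTrialState v h0 htop
  have hΨfin : periodicEnergy v Ψ ≠ ⊤ := by rw [hΨE, hqC]; exact ENNReal.mul_ne_top (ENNReal.inv_ne_top.2 h0) hqRtop
  have hΨEr : (periodicEnergy v Ψ).toReal = m⁻¹ * (e₀ * m + D) := by
    rw [hΨE, ENNReal.toReal_mul, ENNReal.toReal_inv, hmC, hqC, hqRval]
  -- the transfer matrix element is `A/√m`
  have hX : Real.sqrt ((N : ℝ) + 1) * transferIntegralRe L n Ψ.ψ Φ.ψ = (Real.sqrt m)⁻¹ * A := by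
    rw [sqrt_mul_transferIntegralRe, hΨψ, hmC]
    have hfun : (fun Y => conj ((fun X => ((Real.sqrt m)⁻¹ : ℂ) * uC X) Y) * modeAn L (planeWaveMode L n) Φ.ψ Y) =
        fun Y => (((Real.sqrt m)⁻¹ : ℝ) : ℂ) * (uR Y * (conj c * modeAn L (planeWaveMode L n) Φ.ψ Y)) := by
      funext Y
      simp only [huC, huR, map_mul, ← Complex.ofReal_inv, Complex.conj_ofReal]
      ring
    rw [hfun, integral_const_mul, Complex.re_ofReal_mul, hAu]
    congr 1
    have hI : Integrable (fun Y => uR Y * (conj c * modeAn L (planeWaveMode L n) Φ.ψ Y))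
        (volume.restrict (cellN N L)) :=
      integrableOn_cellN (huRC1.continuous.mul (continuous_const.mul haCont)) L
    have h2 := integral_re hI
    simp only [RCLike.re_to_complex] at h2
    rw [← h2]
    refine integral_congr_ae (ae_of_all _ fun Y => ?_)
    simp only [huR, Complex.re_ofReal_mul, hr]
  -- the plain channel bound at `(Φ, Ψ)`: `A²/m ≤ b·D/m`
  have hT := transfer_sq_le_of_suscMinus hb hSM Φ hΦmin Ψ hΨfin
  rw [hX, hΨEr] at hT
  have hmne : m ≠ 0 := hm0.ne'
  have h1 : ((Real.sqrt m)⁻¹ * A) ^ 2 = A ^ 2 / m := by rw [mul_pow, inv_pow, Real.sq_sqrt hm0.le]; ring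
  have h2 : m⁻¹ * (e₀ * m + D) - e₀ = D / m := by field_simp; ring
  rw [h1, h2] at hT
  have h3 : A ^ 2 = A ^ 2 / m * m := by field_simp
  have h4 : b * D = b * (D / m) * m := by field_simp
  rw [h3, h4]
  exact mul_le_mul_of_nonneg_right hT hm0.le

/-! ### The theorem -/

-- The registered signature carries `Continuous Θ₀`, `Continuous Φ₀`, `∀ X, 0 < Φ₀ X` (continuity is re-derived from
-- `C¹` regularity; positivity of `Φ₀` is not needed), so the unused-variables linter is silenced for this declaration.
set_option linter.unusedVariables false in
/-- **Hole-mode Gaussian domination C⁺ from the sibling crux `GaussianDomination` (stmt-AtomisticToContinuum-12620).**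
For a bounded repulsive finite-range `v` and a window `M₀ > 0` there are `B, ρ₃ > 0` such that for `0 < ρ < ρ₃`,
eventually in `N`, on the torus `L = sideLength ρ (N+1)` with bounded periodisation, for the positive continuous
Feynman–Kac ground states `Θ₀` (`N` bodies) and `Φ₀` (`N+1` bodies) and every mode `n ≠ 0` in the window
`‖p‖² ≤ M₀²ρa` (`p = latticeVec (2π/L) n`): `‖Re a(φ_n)Φ₀/Θ₀‖²₋₁ + ‖Im a(φ_n)Φ₀/Θ₀‖²₋₁ ≤ Bρ/‖p‖⁴`. Proof: GD ⇒
`SuscMinus v N L n (CL²/‖n‖²_∞)` (Kato step) at the exact minimiser `Φ₀` ⇒ Kipnis–Varadhan per quadrature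
(`hMinusOneSqW_quadrature_le` with `c = 1, i`) ⇒ `b₋ ≤ 2CL²/‖n‖²_∞ ≤ (24π²CM₀²a + 1)ρ/‖p‖⁴` on the window.
[cite: KLS1988JSP, (12)–(14)] -/
theorem holeModeDomination_of_gaussianDomination
    (hGD : Summit.AtomisticToContinuum.BoseEinsteinCondensation.Theses.BECTwoSectorGD.GaussianDomination)
    (v : ℝ → ℝ≥0∞) (hv : IsRepulsiveFiniteRange v) (hbdd : ∃ C : ℝ≥0, ∀ r, v r ≤ C) (M₀ : ℝ) (hM₀ : 0 < M₀) :
    ∃ B : ℝ, 0 < B ∧ ∃ ρ₃ : ℝ, 0 < ρ₃ ∧ ∀ ρ : ℝ, 0 < ρ → ρ < ρ₃ → ∀ᶠ N : ℕ in atTop,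
      ∀ (L : ℝ), L = sideLength ρ (N + 1) → (∃ C : ℝ≥0, ∀ x, periodizedPotential v L x ≤ C) →
      ∀ (Θ₀ : Config N → ℝ), IsPeriodicGroundStateFK v L Θ₀ → Continuous Θ₀ → (∀ X, 0 < Θ₀ X) →
      ∀ (Φ₀ : Config (N + 1) → ℝ), IsPeriodicGroundStateFK v L Φ₀ → Continuous Φ₀ → (∀ X, 0 < Φ₀ X) →
      ∀ (n : Fin 3 → ℤ), n ≠ 0 →
        ‖latticeVec (2 * Real.pi / L) n‖ ^ 2 ≤ M₀ ^ 2 * ρ * (scatteringLength v).toReal →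
        hMinusOneSqW L Θ₀ (fun Y => (modeAn L (planeWaveMode L n) (fun X => (Φ₀ X : ℂ)) Y).re / Θ₀ Y) +
            hMinusOneSqW L Θ₀ (fun Y => (modeAn L (planeWaveMode L n) (fun X => (Φ₀ X : ℂ)) Y).im / Θ₀ Y) ≤
          ENNReal.ofReal (B * ρ / (‖latticeVec (2 * Real.pi / L) n‖ ^ 2) ^ 2) := by
  have hw : Measurable v := hv.1
  have hint : (∫⁻ x : Space, v ‖x‖) ≠ ⊤ := lintegral_ne_top_of_bounded hv hbdd
  obtain ⟨K, hK, ρ₀, hρ₀, C, hC, hGDv⟩ := gaussianDomination_iff.1 hGD v hv hint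
  have hTC := Kato.twoChannel_of_gd hC hGDv
  set a : ℝ := (scatteringLength v).toReal with ha_def
  have ha : 0 ≤ a := ENNReal.toReal_nonneg
  refine ⟨24 * Real.pi ^ 2 * C * M₀ ^ 2 * a + 1, by positivity, min ρ₀ (K ^ 2 / (M₀ ^ 2 * (a + 1))),
    lt_min hρ₀ (by positivity), fun ρ hρ hρ₃ => ?_⟩
  have hρρ₀ : ρ < ρ₀ := lt_of_lt_of_le hρ₃ (min_le_left _ _)
  have hρK : ρ * (M₀ ^ 2 * (a + 1)) < K ^ 2 :=
    (lt_div_iff₀ (by positivity)).1 (lt_of_lt_of_le hρ₃ (min_le_right _ _))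
  unfold TwoChannelSusceptibility at hTC
  filter_upwards [hTC, eventually_ge_atTop 1] with N hN hN1
  intro L hLdef hb Θ₀ hΘ hΘc hΘp Φ₀ hΦ hΦc hΦp n hn hwin
  have hL : 0 < L := by rw [hLdef]; exact sideLength_succ_pos hρ N
  -- the density condition `(N+1) ≤ ρ₀ L³`
  have hdens : ((N : ℝ) + 1) ≤ ρ₀ * L ^ 3 := by
    have h := div_sideLength_pow_three hρ (Nat.succ_pos N)
    rw [← hLdef, div_eq_iff (pow_pos hL 3).ne'] at h
    push_cast at h
    rw [h]
    exact mul_le_mul_of_nonneg_right hρρ₀.le (pow_pos hL 3).le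
  -- the window forces `2π‖n‖_∞/L ≤ K`
  set S : ℝ := ∑ i, (n i : ℝ) ^ 2 with hS_def
  set ν : ℝ := ‖(fun j => (n j : ℝ))‖ with hν_def
  have hp2 : ‖latticeVec (2 * Real.pi / L) n‖ ^ 2 = (2 * Real.pi / L) ^ 2 * S := b1_norm_latticeVec_sq _ _
  have hS0 : 0 < S := fb_sum_sq_pos hn
  have hν2S : ν ^ 2 ≤ S := supNorm_sq_le_sum_sq n
  have hS3ν : S ≤ 3 * ν ^ 2 := sum_sq_le_three_mul_supNorm_sq n
  have hνnn : 0 ≤ ν := norm_nonneg _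
  have hν0 : 0 < ν := by nlinarith [hνnn, hS0, hS3ν]
  have hnK : 2 * Real.pi / L * ν ≤ K := by
    have hsq : (2 * Real.pi / L * ν) ^ 2 ≤ K ^ 2 := by
      have h1 : M₀ ^ 2 * ρ * a ≤ ρ * (M₀ ^ 2 * (a + 1)) := by nlinarith [sq_nonneg M₀, hρ.le]
      calc (2 * Real.pi / L * ν) ^ 2 = (2 * Real.pi / L) ^ 2 * ν ^ 2 := mul_pow _ _ _
        _ ≤ (2 * Real.pi / L) ^ 2 * S := mul_le_mul_of_nonneg_left hν2S (sq_nonneg _)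
        _ = ‖latticeVec (2 * Real.pi / L) n‖ ^ 2 := hp2.symm
        _ ≤ M₀ ^ 2 * ρ * a := hwin
        _ ≤ K ^ 2 := by linarith
    exact (pow_le_pow_iff_left₀ (by positivity) hK.le two_ne_zero).1 hsq
  -- the two-channel susceptibility bound at `(N, L, n)`
  have hE0 : periodicGroundStateEnergy v N L ≠ ⊤ := hΘ.energy_ne_top
  have hE1 : periodicGroundStateEnergy v (N + 1) L ≠ ⊤ := hΦ.energy_ne_top
  obtain ⟨-, hSM⟩ := hN L hL hdens hE0 hE1 n hn hnK
  have hb0 : 0 ≤ C * L ^ 2 / ν ^ 2 := by positivity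
  -- the `C¹` ground states as trial states attaining the energies
  obtain ⟨Cb, hCb⟩ := hb
  have hΘC1 : ContDiff ℝ 1 Θ₀ := stub_periodicGroundStateRegularity N L v hN1 hL hw ⟨Cb, hCb⟩ Θ₀ hΘ
  have hΦC1 : ContDiff ℝ 1 Φ₀ :=
    stub_periodicGroundStateRegularity (N + 1) L v (Nat.le_add_left 1 N) hL hw ⟨Cb, hCb⟩ Φ₀ hΦ
  obtain ⟨ΘT, hΘT⟩ := exists_trialState_of_fk hΘ hΘC1
  obtain ⟨ΦT, hΦT⟩ := exists_trialState_of_fk hΦ hΦC1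
  have hEΘ : periodicEnergy v ΘT = periodicGroundStateEnergy v N L :=
    le_antisymm (periodicEnergy_le_of_isPeriodicGroundStateFK hL hw hCb hΘ hΘC1 ΘT hΘT)
      (periodicGroundStateEnergy_le v ΘT)
  have hEΦ : periodicEnergy v ΦT = periodicGroundStateEnergy v (N + 1) L :=
    le_antisymm (periodicEnergy_le_of_isPeriodicGroundStateFK hL hw hCb hΦ hΦC1 ΦT hΦT)
      (periodicGroundStateEnergy_le v ΦT)
  have hΘfin : periodicEnergy v ΘT ≠ ⊤ := by rw [hEΘ]; exact hE0
  -- Kipnis–Varadhan per quadrature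
  have hre := hMinusOneSqW_quadrature_le hL hw hint ΘT hΘT hΘp hΘC1 hΘ.periodic hΘ.symm hEΘ hΘfin ΦT hEΦ
    hb0 hSM 1 (by simp)
  have him := hMinusOneSqW_quadrature_le hL hw hint ΘT hΘT hΘp hΘC1 hΘ.periodic hΘ.symm hEΘ hΘfin ΦT hEΦ
    hb0 hSM Complex.I (by simp)
  rw [hΦT] at hre him
  have e1 : (fun Y => (conj (1 : ℂ) * modeAn L (planeWaveMode L n) (fun X => ((Φ₀ X : ℝ) : ℂ)) Y).re / Θ₀ Y) =
      fun Y => (modeAn L (planeWaveMode L n) (fun X => ((Φ₀ X : ℝ) : ℂ)) Y).re / Θ₀ Y := by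
    funext Y; rw [map_one, one_mul]
  have e2 : (fun Y => (conj Complex.I * modeAn L (planeWaveMode L n) (fun X => ((Φ₀ X : ℝ) : ℂ)) Y).re / Θ₀ Y) =
      fun Y => (modeAn L (planeWaveMode L n) (fun X => ((Φ₀ X : ℝ) : ℂ)) Y).im / Θ₀ Y := by
    funext Y; rw [Complex.conj_I, neg_mul, Complex.neg_re, Complex.I_mul_re, neg_neg]
  rw [e1] at hre; rw [e2] at him
  calc _ ≤ ENNReal.ofReal (C * L ^ 2 / ν ^ 2) + ENNReal.ofReal (C * L ^ 2 / ν ^ 2) := add_le_add hre him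
    _ = ENNReal.ofReal (C * L ^ 2 / ν ^ 2 + C * L ^ 2 / ν ^ 2) := (ENNReal.ofReal_add hb0 hb0).symm
    _ ≤ _ := ENNReal.ofReal_le_ofReal ?_
  rw [hp2] at hwin ⊢
  exact window_arith hC.le hL hν0 hS3ν rfl (by positivity) hρ hwin

end Summit.AtomisticToContinuum.BoseEinsteinCondensation.Theorems.CorrectorClosure.InsertionModeGaussianDomination

end
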